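import Summits.QuantumFields.YangMills.Theorems.IR.Negative.TypShellCondUKPcFalseOfWildWire

/-!
# Crux `IR` (stmt-QuantumFields-19354), slot of record `af-pincer-Uc` (sha16 b6e69d9662b5b07a):
# the lead stub's statement `OnsetMixingTypicalUKPc` versus FORCED `π₁(G)`-MONOPOLE WORLD-LINES
# (disprove-1 g6, Negative lane — the strongest counterexample family to date; kernel part)

`stub_onsetUc : OnsetMixingTypicalUKPc` (slot S3, the LEAD stub) asserts, for EVERY compact simple `G` — the
tree's `IsCompactSimpleLieGroup` admits non-simply-connected groups, and `SO(3)` is CERTIFIED admissible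
(`NonSimplyConnectedLatticeGap.isCompactSimpleLieGroup_SO3`, `not_simplyConnectedSpace_SO3`) — and every lattice
representation `r`: some window parameter `n` and budget `ε`, then for every `δ > 0`, at all large `β`, SOME mesh
`b ≥ 1` carries format Uc, `TypShellCondUKPc r.ρ β b n ε δ`.  It is UNCONDITIONAL in `(G, r)` (no `NT`, no units).

Kernel content of this file (sorry-free, standard axioms):
* `WildWireEachWindow ρ := ∀ n ≥ 1, ∃ β₀, ∀ β ≥ β₀, ∀ b ≥ 1, WildWireAt ρ β b n` — the wild wire of p514971 with
  the threshold `β₀` allowed to depend on the window parameter `n` (WEAKER than `WildWire ρ`, which has one `β₀`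
  for all `n`; `WildWire.eachWindow`).  Because the stub fixes `n` BEFORE `β`, this weaker wire already kills it:
  `not_onsetMixingTypicalUKPc_of_wildWireEachWindow : (∃ r, WildWireEachWindow r.ρ) → ¬ OnsetMixingTypicalUKPc`
  for any one admissible `G`.
* `MonopoleWire := ∃ G` admissible with `¬ SimplyConnectedSpace G` and `∃ r : LatticeRep G, WildWireEachWindow r.ρ`
  (instantiated in the intended world by `G = SO(3)`, certified admissible and not simply connected in the tree:
  `Theorems.NonSimplyConnectedLatticeGap.isCompactSimpleLieGroup_SO3`, `not_simplyConnectedSpace_SO3` — not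
  imported here to keep this lane outside the `ConvexGribovBody` route cone) and
  `not_onsetMixingTypicalUKPc_of_monopoleWire : MonopoleWire → ¬ OnsetMixingTypicalUKPc`.  `MonopoleWire` is the
  hypothesis `H` of the memo's «what would make (A) go through».
* `OnsetMixingTypicalUKPcSC` — the stub restricted to SIMPLY CONNECTED `G` (the minimal repaired statement C′ of
  repair (R1) below), with `onsetMixingTypicalUKPcSC_of_UKPc : OnsetMixingTypicalUKPc → OnsetMixingTypicalUKPcSC`.

Why `MonopoleWire` is expected TRUE at `G = SO(3)` in the intended world (PHYSICS-GRADE — not a theorem of this file; the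
mechanism is the tree's own, `Cruxes/NonSimplyConnectedLatticeGap/ForcedMonopoleLines.md` §§1–3, lead c5 of crux
stmt-QuantumFields-16405, where it killed the «all exterior data» leaf A' and forced the reshape v9 → averaged A″):
(1) [lattice combinatorics, rigorous on paper, ibid. §1] for `G = G̃/Z'`, `Z' = π₁(G) ≠ 1`, every configuration
carries a CLOSED `Z'`-valued monopole current `σ` on 3-cubes (for `SO(3)`: `σ_c = ∏_{p ∈ ∂c} sign tr_F Ũ_∂p`,
[Mack–Pietarinen, Nucl. Phys. B205 (1982) 141, eqs. (1.1a,b): lift independent, conserved, «the world lines of the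
monopoles are closed loops on the dual lattice»; reprinted in Rebbi (ed.), *Lattice Gauge Theories and Monte Carlo
Simulations*, p. 399]), gauge invariant and local; a monopole cube costs Wilson action `≥ a₀ β` (Bianchi +
faithfulness; ibid. (2.1): `ρ_c = 1` when the faces are near `1`), the Dirac sheet is free (`r` is blind to `Z'`;
in the `SU(2)` theory the same monopoles «are attached to ℤ₂ strings that carry energy», ibid.).  (2) [deterministic, ibid. §2]
an exterior datum `ζ₁ = U^∞` carrying one straight bi-infinite line along the time axis, aimed at the centre cell,
forces — by conservation — net flux `w₀ ≠ 1` through every time slice of the resampled region `regionEdges w F'`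
(`F' = collarBlock n`, a box of `(4n+5)⁴` cells of width `2b`, time extent `H = (8n+10)b`), for EVERY configuration the
kernel `γ_{F'}(· | ζ₁)` charges (completions inside the boundary layer are longer by `≳ H` and suppressed); the
flat datum `ζ₀ ≡ 1` forces flux `1`.  (3) [energetics, physics-grade, ibid. §3 (E)] beyond the bulk monopole
transition the forced line is a directed polymer of tension `τ(β) ≥ c₀β − O(1)` per LATTICE unit with no sheet
cost; on the lattice a transverse excursion of size `k` costs `2k` extra cubes (ℓ¹ geometry), so its transverse
displacement at mid-height is `≲ √(H e^{−2τ})`.  Centre cell of width `2b`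
(frame `w i j = 2bj − b`, mesh `b`): the line crosses the cell from its bottom time-face to its top time-face
unless the displacement exceeds `≈ b/2`, i.e. with `γ(·|ζ₁)`-probability `≥ 2/3` as soon as `c(n) e^{−2τ(β)} ≤ 1`
— ONE threshold `β₀(n)` for ALL meshes `b ≥ 1` (for `b ≲ e^{2τ}/n` the line has no kink at all; for larger `b`
the diffusive displacement `√((8n+10) b e^{−2τ})` is `≪ b`).  Under `ζ₀` the cell event `A :=` «a connected path of
monopole cubes inside the centre cell joins its two time-faces» needs `≥ 2b` monopole cubes: Peierls,
`γ(A|ζ₀) ≤ (2b)³ Σ_{ℓ ≥ 2b} (7e^{−c₀β+O(1)})^ℓ ≤ 1/3` for all `b ≥ 1` at large `β`.  `A` is measurable and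
determined by the centre cell's edges.  Hence `WildWireAt r.ρ β b n` for all `b ≥ 1`, `β ≥ β₀(n)`: that is
`WildWireEachWindow r.ρ` for the defining representation of `SO(3)` — `MonopoleWire`.  What a KERNEL proof
would need: the explicit datum `U^∞` (a DeGrand–Toussaint / Dirac construction), the conservation law (finite
combinatorics), and the two Peierls estimates INSIDE a region with fixed exterior data at large `β` (no reflection
positivity there — «out of reach» per ibid. §3; cf. the open classical stub CHESS of that crux).  The uniform wire
`WildWire` (one `β₀` for all `n`) is NOT obtained: at fixed `β` and `n ≳ e^{2τ}` the line delocalises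
(influence `∼ c(β) n^{−3/2}` at `b = 1`, ibid. §0).

Consequences for the slot (for the owner; numbers not adjectives).  S3 as typed is false at physics grade for
every admissible `G` with `π₁(G) ≠ 1` (`SO(3)`, `SU(N)/Z_N`, …); S1 (`TypCriterionUKPc`, an implication FROM the
format) and S2 (`AFToOnsetUKPc`, vacuous when the onset set is empty: `mixOnsetUc = sInf ∅ = 0`) are untouched; `IR`
itself is not threatened (torus, no boundary: data forcing a line through the region need a monopole loop of length
`≥ 2H`, of torus mass `≤ (7e^{−c₀β+O(1)})^{2H} → 0` — such data are NOT typical).  Repairs, smallest first: (R1) restrict S3 (hence the pincer's conclusion) to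
`SimplyConnectedSpace G` — C′ = `OnsetMixingTypicalUKPcSC` below — and route `π₁ ≠ 1` through a separate residual;
(R2) R59-U's reversal trigger («a typed negative kills a UKP-specific clause in the intended world») is met for
`π₁ ≠ 1`: revert those groups to the typical-data format T (`MassWire`-type data have torus mass `≥ p`; forcing data
have mass `→ 0`, so T survives the mechanism exactly as A″ survived in crux 16405); (R3) keep Uc but restrict the
exterior data to a measurable gauge-invariant «no `Z'`-flux through the region» class (the GOOD-data format of
crux 16405 v13, stub P2).  For simply connected `G` (`SU(2)`: centre sheets cost area, ibid. §1 «the sheet is NOT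
free») no forced defect is known and the verdict of record (B) NOT REFUTED stands (memo §11).
-/

set_option autoImplicit false

noncomputable section

open Filter Topology MeasureTheory
open Literature.MathematicalPhysics.QuantumFieldTheory Literature.MathematicalPhysics.QuantumLattice
open Summit.QuantumFields.YangMills.Cruxes.IR.ShellTempered (windowCellsPlus)
open Summit.QuantumFields.YangMills.Cruxes.IR.Tempered (windowCells)
open Summit.QuantumFields.YangMills.Cruxes.IR.OnsetFormats (shellCount)
open Summit.QuantumFields.YangMills.Cruxes.IR.FixedMesh (sixteen_mul_eps_lt_one)

namespace Summit.QuantumFields.YangMills.Cruxes.IR.OnsetFormatsUc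

section Wire

variable {G : Type} [Group G] [TopologicalSpace G] [IsTopologicalGroup G] [CompactSpace G]
  [MeasurableSpace G] [BorelSpace G]

/-- **Each-window wild wire**: for EVERY window parameter `n ≥ 1` there is a threshold `β₀ = β₀(n)` beyond which,
at EVERY mesh `b ≥ 1`, two exterior data polarise (`≤ 1/3` vs `≥ 2/3`) some centre-cell event through a finite
region containing the `(2n+2)`-collar block (`WildWireAt`, p514971).  Weaker than `WildWire` (one `β₀` for all
`n`); the shape produced by a forced `π₁(G)`-monopole world-line (module docstring). -/
def WildWireEachWindow {N : ℕ} (ρ : G →* Matrix (Fin N) (Fin N) ℂ) : Prop :=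
  ∀ n : ℕ, 1 ≤ n → ∃ β₀ : ℝ, ∀ β : ℝ, β₀ ≤ β → ∀ b : ℕ, 1 ≤ b → WildWireAt ρ β b n

/-- A (uniform) wild wire is an each-window wild wire. -/
theorem WildWire.eachWindow {N : ℕ} {ρ : G →* Matrix (Fin N) (Fin N) ℂ} (h : WildWire ρ) :
    WildWireEachWindow ρ := by
  obtain ⟨β₀, hβ⟩ := h
  exact fun n hn => ⟨β₀, fun β hβ0 b hb => hβ β hβ0 b n hb hn⟩

/-- **An each-window wild wire for `r.ρ` refutes `stub_onsetUc`'s conclusion at `(G, r)`**: the stub fixes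
`(n, ε)` first (`ε·M(n) ≤ 3/4`, so `16ε < 1`); at the budget `δ = 1/(16(#shell + 1))` and any `β` beyond both the
stub's `β₂(δ)` and the wire's `β₀(n)`, NO mesh `b ≥ 1` carries format Uc (`not_typShellCondUKPc_of_wildWireAt`,
p514971: `2ε + 2·#shell·δ < 1/3`). -/
theorem onsetMixingTypicalUKPcAt_false_of_wildWireEachWindow [T2Space G] [SecondCountableTopology G]
    (r : LatticeRep G) (hW : WildWireEachWindow r.ρ) :
    ¬ ∃ (n : ℕ) (ε : ℝ), 1 ≤ n ∧ 0 ≤ ε ∧ ε * shellCount n ≤ 3 / 4 ∧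
        ∀ δ : ℝ, 0 < δ → ∃ β₂ : ℝ, ∀ β : ℝ, β₂ ≤ β → ∃ b : ℕ, 1 ≤ b ∧ TypShellCondUKPc r.ρ β b n ε δ := by
  rintro ⟨n, ε, hn, hε0, hM, hIδ⟩
  obtain ⟨β₀, hwire⟩ := hW n hn
  have h16 : 16 * ε < 1 := sixteen_mul_eps_lt_one (by linarith) hε0
  set k : ℝ := ((windowCellsPlus n \ windowCells n).card : ℝ) with hk
  have hk0 : 0 ≤ k := Nat.cast_nonneg _
  have hδ0 : 0 < 1 / (16 * (k + 1)) := by positivity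
  obtain ⟨β₂, hon⟩ := hIδ _ hδ0
  obtain ⟨b, hb, hT⟩ := hon (max β₀ β₂) (le_max_right _ _)
  have hkk : k / (k + 1) < 1 := (div_lt_one (by positivity)).mpr (by linarith)
  have h2 : 16 * (k * (1 / (16 * (k + 1)))) < 1 := by
    rw [mul_one_div, ← mul_div_assoc, mul_div_mul_left k (k + 1) (by norm_num : (16 : ℝ) ≠ 0)]
    exact hkk
  have hlt : 2 * ε + 2 * (k * (1 / (16 * (k + 1)))) < 1 / 3 := by linarith
  exact not_typShellCondUKPc_of_wildWireAt r.continuous (hwire _ (le_max_left _ _) b hb) hε0 hδ0.le hlt hT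

end Wire

/-- **An each-window wild wire for ONE lattice representation of ONE compact simple `G` refutes
`OnsetMixingTypicalUKPc`** (the statement of the slot's lead stub `stub_onsetUc`). -/
theorem not_onsetMixingTypicalUKPc_of_wildWireEachWindow (G : Type) [Group G] [TopologicalSpace G]
    [IsTopologicalGroup G] [CompactSpace G] (hG : IsCompactSimpleLieGroup G)
    (hW : letI : MeasurableSpace G := borel G; haveI : BorelSpace G := ⟨rfl⟩;
      ∃ r : LatticeRep G, WildWireEachWindow r.ρ) : ¬ OnsetMixingTypicalUKPc := by
  intro hI
  letI : MeasurableSpace G := borel G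
  haveI : BorelSpace G := ⟨rfl⟩
  obtain ⟨r, hWr⟩ := hW
  haveI : T2Space G := T2Space.of_injective_continuous r.injective r.continuous
  haveI : SecondCountableTopology G :=
    (r.continuous.isClosedEmbedding r.injective).isEmbedding.secondCountableTopology
  exact onsetMixingTypicalUKPcAt_false_of_wildWireEachWindow r hWr (hI G hG r)

/-- **The monopole wire** (hypothesis `H` of the memo; PHYSICS-GRADE TRUE at `G = SO(3)` by the forced
`ℤ₂`-monopole world-line, module docstring): some admissible compact simple gauge group which is NOT simply
connected carries, in some lattice representation, an each-window wild wire.  (`SO(3)` is certified admissible and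
not simply connected in the tree: `Theorems.NonSimplyConnectedLatticeGap.isCompactSimpleLieGroup_SO3`,
`not_simplyConnectedSpace_SO3`.)  A closed `Prop`, never asserted here. -/
def MonopoleWire : Prop :=
  ∃ (G : Type) (_ : Group G) (_ : TopologicalSpace G) (_ : IsTopologicalGroup G) (_ : CompactSpace G),
    IsCompactSimpleLieGroup G ∧ ¬ SimplyConnectedSpace G ∧
      (letI : MeasurableSpace G := borel G; haveI : BorelSpace G := ⟨rfl⟩;
        ∃ r : LatticeRep G, WildWireEachWindow r.ρ)

/-- **`MonopoleWire → ¬ OnsetMixingTypicalUKPc`**: the lead stub's statement — typed over ALL compact simple `G` —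
is false as soon as one non-simply-connected admissible group carries the forced-monopole wire. -/
theorem not_onsetMixingTypicalUKPc_of_monopoleWire (h : MonopoleWire) : ¬ OnsetMixingTypicalUKPc := by
  obtain ⟨G, _, _, _, _, hG, -, hW⟩ := h
  exact not_onsetMixingTypicalUKPc_of_wildWireEachWindow G hG hW

/-- **Repair (R1), the minimal repaired statement C′**: `stub_onsetUc`'s statement restricted to SIMPLY CONNECTED
compact simple `G` (e.g. `SU(N)`), where no forced `π₁`-defect exists and the verdict of record is NOT REFUTED.
The monopole witness misses C′ by construction. -/
def OnsetMixingTypicalUKPcSC : Prop :=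
  ∀ (G : Type) [Group G] [TopologicalSpace G] [IsTopologicalGroup G] [CompactSpace G],
    IsCompactSimpleLieGroup G → SimplyConnectedSpace G →
    letI : MeasurableSpace G := borel G; haveI : BorelSpace G := ⟨rfl⟩;
    ∀ r : LatticeRep G, ∃ (n : ℕ) (ε : ℝ), 1 ≤ n ∧ 0 ≤ ε ∧ ε * shellCount n ≤ 3 / 4 ∧
      ∀ δ : ℝ, 0 < δ → ∃ β₂ : ℝ, ∀ β : ℝ, β₂ ≤ β → ∃ b : ℕ, 1 ≤ b ∧ TypShellCondUKPc r.ρ β b n ε δ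

/-- The stub as typed implies its simply-connected restriction (so C′ is a genuine weakening). -/
theorem onsetMixingTypicalUKPcSC_of_UKPc (h : OnsetMixingTypicalUKPc) : OnsetMixingTypicalUKPcSC :=
  fun G _ _ _ _ hG _ => h G hG

end Summit.QuantumFields.YangMills.Cruxes.IR.OnsetFormatsUc

end
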